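import Literature.NumberTheory.Automorphic.AdelicAffineTwistLocalBounds
import Literature.NumberTheory.NumberFields.DenominatorIdealRegrouping
import Literature.NumberTheory.NumberFields.TotallyRealIntegerTranslateSum
import HarnessLib

/-!
# The sharp count `s^d · Σ_{ξ ∈ F} h(1, ((ξ:𝔸)+β′)·u·ρ_s)^{-N} ≤ C`, uniform over compact translates and dilations

Topic `NumberTheory/Automorphic`; namespace `Literature.NumberTheory.Automorphic`.  KERNEL only: proved theorems, no definition,
no named fact, no `sorry`.

Let `F` be a totally real number field of degree `d`, `N > 2`, `K_F ⊆ 𝔸_F` and `U ⊆ 𝔸_Fˣ` compact.  Then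
(`exists_forall_pow_mul_tsum_vecHeight_affineTwist_rpow_neg_le`) there is `C` such that for all `β′ ∈ K_F`, `u ∈ U` and
`0 < s ≤ 1`,

  `s^d · Σ'_{ξ ∈ F} h(1, ((ξ : 𝔸_F) + β′)·u·ρ_s)^{-N} ≤ C`

(`h` = the Godement–Garrett vector height ★ `AdelicVectorHeight.vecHeight`, `ρ_s = posRealIdele F s`), the series being summable.
Proof: split `h(1,η)^{-N} ≤ arch^{-N}·fin^{-N}` (★ `AdelicHeightAffineLineAdele`); the finite factor is `≥ c·Π_v max(1,|ξ|_v)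
= c·N(𝔡_ξ)` uniformly on the compacts (★ `AdelicAffineTwistLocalBounds`, ★ `DenominatorIdealFiniteHeight`); the archimedean
factor is the product weight `Π_w max(1, |r_w(u_w)((r_w(β′_w)+σ_w ξ)s)|)^{-N}` whose sums over translates of `𝓞_F` are
`≪ (1 + s^{-d})` (★ `TotallyRealIntegerTranslateSum`, from ★ `LatticeSumDilationBound`); regrouping by denominator ideals
(★ `DenominatorIdealRegrouping`: `[𝔡⁻¹:𝓞_F] = N𝔡`, `Σ_𝔡 N𝔡^{1-N} < ∞`) gives the claim.  This is Weil's convergence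
argument for the Fourier coefficients of Siegel–Eisenstein series in the range `N > 2` [Weil1965, n° 41 (Lemme 18 via n° 12,
Lemme 5); Garrett2018, §2.3], in the adelic-height currency of the cell's (E3′) letter (sheet `F0/P4/SW2c-BOUND-ASSEMBLY` §2).
Cell `hodgecm-mathlib`, FLOOR 0, E-2 desk, crux item H413, row SW2c-BOUND (E3′).  HC_CM is proved only modulo the 7 printed
citations until rung 0 closes; this file is unconditional.

## References
* [Weil1965] A. Weil, *Sur la formule de Siegel dans la théorie des groupes classiques*, Acta Math. 113 (1965), n° 12 & 41.
* [Garrett2018] P. Garrett, *Modern Analysis of Automorphic Forms by Example* (2018), §2.2–2.3.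
-/

set_option autoImplicit false

noncomputable section

open scoped NNReal Matrix
open NumberField IsDedekindDomain NumberField.InfinitePlace NumberField.InfinitePlace.Completion
open _root_.MeasureTheory

namespace Literature.NumberTheory.Automorphic

variable (K : Type) [Field K] [NumberField K]

omit [NumberField K] in
/-- `mult w = 1` at every place of a totally real field. [cite: Weil1965, n° 41] -/
theorem mult_eq_one_of_isTotallyReal [IsTotallyReal K] (w : InfinitePlace K) : w.mult = 1 :=
  mult_isReal ⟨w, IsTotallyReal.isReal w⟩

/-- The archimedean components of an idele in a compact set are bounded below: `λ ≤ |r_w(u_w)|`.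
[cite: Garrett2018, Thm. 2.2.2 (PDF p. 82)] -/
theorem exists_pos_le_abs_extensionEmbeddingOfIsReal_of_isCompact [IsTotallyReal K]
    {U : Set (AdeleRing (𝓞 K) K)ˣ} (hU : IsCompact U) :
    ∃ lam : ℝ, 0 < lam ∧ ∀ u ∈ U, ∀ w : InfinitePlace K,
      lam ≤ |extensionEmbeddingOfIsReal (IsTotallyReal.isReal w) ((u : AdeleRing (𝓞 K) K).1 w)| := by
  classical
  have hb : ∀ w : InfinitePlace K, ∃ C : ℝ, ∀ u ∈ U,
      ‖((u⁻¹ : (AdeleRing (𝓞 K) K)ˣ) : AdeleRing (𝓞 K) K).1 w‖ ≤ C := fun w =>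
    hU.exists_bound_of_continuousOn
      (((continuous_apply w).comp (continuous_fst.comp Units.continuous_coe_inv)).continuousOn)
  choose Cu hCu using hb
  set Λ : ℝ := 1 + ∑ w, |Cu w| with hΛdef
  have hΛ1 : 1 ≤ Λ := by
    rw [hΛdef]
    exact le_add_of_nonneg_right (Finset.sum_nonneg fun w _ => abs_nonneg _)
  have hΛ0 : 0 < Λ := lt_of_lt_of_le one_pos hΛ1
  refine ⟨Λ⁻¹, inv_pos.2 hΛ0, fun u hu w => ?_⟩
  rw [← norm_eq_abs_extensionEmbeddingOfIsReal K]
  have h3 : ‖(u : AdeleRing (𝓞 K) K).1 w‖ * ‖((u⁻¹ : (AdeleRing (𝓞 K) K)ˣ) : AdeleRing (𝓞 K) K).1 w‖ = 1 := by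
    rw [← norm_mul, show (u : AdeleRing (𝓞 K) K).1 w * ((u⁻¹ : (AdeleRing (𝓞 K) K)ˣ) : AdeleRing (𝓞 K) K).1 w =
      ((u * u⁻¹ : (AdeleRing (𝓞 K) K)ˣ) : AdeleRing (𝓞 K) K).1 w from rfl, mul_inv_cancel, Units.val_one]
    exact norm_one
  have hle : ‖((u⁻¹ : (AdeleRing (𝓞 K) K)ˣ) : AdeleRing (𝓞 K) K).1 w‖ ≤ Λ :=
    (hCu w u hu).trans ((le_abs_self _).trans
      ((Finset.single_le_sum (fun w' _ => abs_nonneg (Cu w')) (Finset.mem_univ w)).trans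
        (by rw [hΛdef]; linarith)))
  have hpos : 0 < ‖((u⁻¹ : (AdeleRing (𝓞 K) K)ˣ) : AdeleRing (𝓞 K) K).1 w‖ := by
    rcases (norm_nonneg (((u⁻¹ : (AdeleRing (𝓞 K) K)ˣ) : AdeleRing (𝓞 K) K).1 w)).lt_or_eq with h | h
    · exact h
    · rw [← h, mul_zero] at h3
      exact absurd h3 zero_ne_one
  calc Λ⁻¹ ≤ (‖((u⁻¹ : (AdeleRing (𝓞 K) K)ˣ) : AdeleRing (𝓞 K) K).1 w‖)⁻¹ := inv_anti₀ hpos hle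
    _ = ‖(u : AdeleRing (𝓞 K) K).1 w‖ := (eq_inv_of_mul_eq_one_left h3).symm

/-- **The sharp count (E3′).**  For a totally real `K` of degree `d`, `N > 2`, and compact `K_F ⊆ 𝔸_K`, `U ⊆ 𝔸_Kˣ`, there is
`C` with `s^d · Σ'_{ξ ∈ K} h(1, ((ξ:𝔸) + β)·u·ρ_s)^{-N} ≤ C` for all `β ∈ K_F`, `u ∈ U`, `0 < s ≤ 1` (and the series is
summable). [cite: Weil1965, n° 41 (Lemme 18)] -/
theorem exists_forall_pow_mul_tsum_vecHeight_affineTwist_rpow_neg_le [IsTotallyReal K] {N : ℝ} (hN : 2 < N)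
    {KF : Set (AdeleRing (𝓞 K) K)} (hKF : IsCompact KF) {U : Set (AdeleRing (𝓞 K) K)ˣ} (hU : IsCompact U) :
    ∃ C : ℝ, ∀ β ∈ KF, ∀ u ∈ U, ∀ s : ℝ≥0ˣ, ((s : ℝ≥0) : ℝ) ≤ 1 →
      Summable (fun ξ : K => ((vecHeight K
        (![1, (algebraMap K (AdeleRing (𝓞 K) K) ξ + β) * (u : AdeleRing (𝓞 K) K) *
          ((posRealIdele K s : (AdeleRing (𝓞 K) K)ˣ) : AdeleRing (𝓞 K) K)] : Fin 2 → AdeleRing (𝓞 K) K) : ℝ≥0) : ℝ) ^ (-N)) ∧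
      ((s : ℝ≥0) : ℝ) ^ Module.finrank ℚ K * ∑' ξ : K, ((vecHeight K
        (![1, (algebraMap K (AdeleRing (𝓞 K) K) ξ + β) * (u : AdeleRing (𝓞 K) K) *
          ((posRealIdele K s : (AdeleRing (𝓞 K) K)ˣ) : AdeleRing (𝓞 K) K)] : Fin 2 → AdeleRing (𝓞 K) K) : ℝ≥0) : ℝ) ^ (-N)
        ≤ C := by
  classical
  have hN0 : 0 ≤ N := by linarith
  have hN1 : 1 < N := by linarith
  have hσ : 1 < N - 1 := by linarith
  -- the constants
  obtain ⟨c, hc0, hc⟩ := exists_pos_mul_finprod_max_one_le_of_isCompact K hKF hU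
  obtain ⟨C₁, hC₁0, hC₁⟩ := Literature.NumberTheory.NumberFields.exists_forall_tsum_ringOfIntegers_prod_le K
  obtain ⟨lam, hlam0, hlam⟩ := exists_pos_le_abs_extensionEmbeddingOfIsReal_of_isCompact K hU
  have hZs := summable_absNorm_rpow_neg (K := K) hσ
  set Z : ℝ := ∑' 𝔡 : Ideal (𝓞 K), (Ideal.absNorm 𝔡 : ℝ) ^ (-(N - 1)) with hZdef
  have hZ0 : 0 ≤ Z := tsum_nonneg fun 𝔡 => Real.rpow_nonneg (Nat.cast_nonneg _) _
  set IN : ℝ := ∫ y : ℝ, (max 1 |y|) ^ (-N) with hINdef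
  have hIN0 : 0 ≤ IN := integral_nonneg fun y => max_one_abs_rpow_neg_nonneg N y
  set d : ℕ := Fintype.card (InfinitePlace K) with hddef
  have hcR0 : (0 : ℝ) < (c : ℝ) := by exact_mod_cast hc0
  have hcN0 : (0 : ℝ) < (c : ℝ) ^ (-N) := Real.rpow_pos_of_pos hcR0 _
  set Q : ℝ := (1 + lam⁻¹ * IN) ^ d with hQdef
  refine ⟨2 * (c : ℝ) ^ (-N) * C₁ * Q * Z, fun β hβ u hu s hs1 => ?_⟩
  -- `#(infinite places) = [K:ℚ]` for a totally real field (cf. the HodgeTheory-side lemma of the same name; not imported here)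
  have hcard : Fintype.card (InfinitePlace K) = Module.finrank ℚ K := by
    rw [card_eq_nrRealPlaces_add_nrComplexPlaces, IsTotallyReal.nrComplexPlaces_eq_zero, add_zero,
      IsTotallyReal.finrank]
  rw [← hcard]
  -- notation for this `β, u, s`
  set t : ℝ := ((s : ℝ≥0) : ℝ) with htdef
  have ht0 : 0 < t := NNReal.coe_pos.2 (pos_iff_ne_zero.2 s.ne_zero)
  -- archimedean data of `u` and `β`
  set cw : InfinitePlace K → ℝ := fun w =>
    extensionEmbeddingOfIsReal (IsTotallyReal.isReal w) ((u : AdeleRing (𝓞 K) K).1 w) with hcwdef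
  set bw : InfinitePlace K → ℝ := fun w =>
    extensionEmbeddingOfIsReal (IsTotallyReal.isReal w) (β.1 w) with hbwdef
  have hcw : ∀ w, lam ≤ |cw w| := fun w => hlam u hu w
  have hcw0 : ∀ w, cw w ≠ 0 := fun w h => by
    have h' := hcw w
    rw [h, abs_zero] at h'
    exact absurd h' (not_le.mpr hlam0)
  -- the weight
  set g : InfinitePlace K → ℝ → ℝ := fun w y => (max 1 |cw w * y|) ^ (-N) with hgdef
  set wt : K → ℝ := fun ξ => (c : ℝ) ^ (-N) *
    ∏ w, g w ((bw w + embedding_of_isReal (IsTotallyReal.isReal w) ξ) * t) with hwtdef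
  have hg0 : ∀ w y, 0 ≤ g w y := fun w y => max_one_abs_rpow_neg_nonneg N _
  have hwt0 : ∀ ξ, 0 ≤ wt ξ := fun ξ => mul_nonneg hcN0.le (Finset.prod_nonneg fun w _ => hg0 w _)
  set D : K → ℝ := fun ξ =>
    (((∏ᶠ v : HeightOneSpectrum (𝓞 K), max 1 ‖(ξ : v.adicCompletion K)‖₊ : ℝ≥0) : ℝ)) with hDdef
  set η : K → AdeleRing (𝓞 K) K := fun ξ => (algebraMap K (AdeleRing (𝓞 K) K) ξ + β) * (u : AdeleRing (𝓞 K) K) *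
    ((posRealIdele K s : (AdeleRing (𝓞 K) K)ˣ) : AdeleRing (𝓞 K) K) with hηdef
  -- the pointwise estimate `h(1,η_ξ)^{-N} ≤ wt(ξ) · D(ξ)^{-N}`
  have hP : ∀ ξ : K, ((vecHeight K (![1, η ξ] : Fin 2 → AdeleRing (𝓞 K) K) : ℝ≥0) : ℝ) ^ (-N) ≤
      wt ξ * D ξ ^ (-(N - 1 + 1)) := by
    intro ξ
    have hexp : -(N - 1 + 1) = -N := by ring
    rw [hexp]
    have h1 := vecHeight_vecCons_one_adele_rpow_neg_le K (η ξ) hN0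
    have hA : (((∏ w : InfinitePlace K, (max 1 ‖(η ξ).1 w‖₊) ^ w.mult : ℝ≥0) : ℝ)) ^ (-N) =
        ∏ w, g w ((bw w + embedding_of_isReal (IsTotallyReal.isReal w) ξ) * t) := by
      push_cast
      rw [← Real.finsetProd_rpow _ _ (fun w _ => by positivity)]
      refine Finset.prod_congr rfl fun w _ => ?_
      rw [mult_eq_one_of_isTotallyReal K w, pow_one]
      simp only [hgdef, hcwdef, hbwdef, htdef, hηdef]
      rw [norm_fst_affineTwist K (IsTotallyReal.isReal w) ξ β (u : AdeleRing (𝓞 K) K) s]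
    have hB : (((∏ᶠ v : HeightOneSpectrum (𝓞 K), max 1 ‖(η ξ).2 v‖₊ : ℝ≥0) : ℝ)) ^ (-N) ≤
        (c : ℝ) ^ (-N) * D ξ ^ (-N) := by
      have hle : (c : ℝ) * D ξ ≤ (((∏ᶠ v : HeightOneSpectrum (𝓞 K), max 1 ‖(η ξ).2 v‖₊ : ℝ≥0) : ℝ)) := by
        rw [hDdef]
        exact_mod_cast hc β hβ u hu s ξ
      have hD1 : 1 ≤ D ξ := by
        rw [hDdef]
        exact_mod_cast one_le_finprod' fun v : HeightOneSpectrum (𝓞 K) => le_max_left 1 ‖(ξ : v.adicCompletion K)‖₊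
      have hpos : 0 < (c : ℝ) * D ξ := mul_pos hcR0 (by linarith)
      rw [← Real.mul_rpow hcR0.le (by linarith)]
      exact Real.rpow_le_rpow_of_nonpos hpos hle (by linarith)
    calc _ ≤ _ := h1
      _ = (∏ w, g w ((bw w + embedding_of_isReal (IsTotallyReal.isReal w) ξ) * t)) *
            (((∏ᶠ v : HeightOneSpectrum (𝓞 K), max 1 ‖(η ξ).2 v‖₊ : ℝ≥0) : ℝ)) ^ (-N) := by rw [hA]
      _ ≤ (∏ w, g w ((bw w + embedding_of_isReal (IsTotallyReal.isReal w) ξ) * t)) *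
            ((c : ℝ) ^ (-N) * D ξ ^ (-N)) :=
          mul_le_mul_of_nonneg_left hB (Finset.prod_nonneg fun w _ => hg0 w _)
      _ = wt ξ * D ξ ^ (-N) := by
          simp only [hwtdef]
          ring
  -- the uniform count over translates of `𝓞 K`
  have hM : ∀ a : K, Summable (fun x : 𝓞 K => wt (a + x)) ∧ ∑' x : 𝓞 K, wt (a + x) ≤
      (c : ℝ) ^ (-N) * (C₁ * (1 + t⁻¹ ^ d) * ∏ w, (1 + |(cw w)⁻¹| * IN)) := by
    intro a
    have hT : 0 < t⁻¹ := inv_pos.2 ht0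
    obtain ⟨hs, hle⟩ := hC₁ g hg0 (fun w s' t' hst => max_one_abs_mul_rpow_neg_anti hN0 (cw w) hst)
      (fun w => integrable_max_one_abs_mul_rpow_neg hN1 (hcw0 w)) t⁻¹ hT
      (fun w => bw w + embedding_of_isReal (IsTotallyReal.isReal w) a)
    have hfun : (fun x : 𝓞 K => wt (a + x)) = fun x : 𝓞 K => (c : ℝ) ^ (-N) *
        ∏ w, g w ((bw w + embedding_of_isReal (IsTotallyReal.isReal w) a +
          embedding_of_isReal (IsTotallyReal.isReal w) (x : K)) / t⁻¹) := by
      funext x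
      simp only [hwtdef]
      congr 1
      refine Finset.prod_congr rfl fun w _ => ?_
      rw [map_add, div_inv_eq_mul, add_assoc]
    rw [hfun]
    refine ⟨hs.mul_left _, ?_⟩
    rw [tsum_mul_left]
    refine mul_le_mul_of_nonneg_left (hle.trans (le_of_eq ?_)) hcN0.le
    rw [hddef]
    congr 1
    refine Finset.prod_congr rfl fun w _ => ?_
    simp only [hgdef]
    rw [max_one_abs_mul_zero_rpow_neg, integral_max_one_abs_mul_rpow_neg]
  -- regroup by denominator ideals
  obtain ⟨hS, hT⟩ :=
    Literature.NumberTheory.NumberFields.summable_and_tsum_mul_finprod_rpow_neg_le K hwt0 hM hσ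
  have hHnn : ∀ ξ : K, 0 ≤ ((vecHeight K (![1, η ξ] : Fin 2 → AdeleRing (𝓞 K) K) : ℝ≥0) : ℝ) ^ (-N) :=
    fun ξ => Real.rpow_nonneg (NNReal.coe_nonneg _) _
  have hSum : Summable (fun ξ : K => ((vecHeight K (![1, η ξ] : Fin 2 → AdeleRing (𝓞 K) K) : ℝ≥0) : ℝ) ^ (-N)) :=
    hS.of_nonneg_of_le hHnn hP
  refine ⟨hSum, ?_⟩
  have htsum : ∑' ξ : K, ((vecHeight K (![1, η ξ] : Fin 2 → AdeleRing (𝓞 K) K) : ℝ≥0) : ℝ) ^ (-N) ≤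
      (c : ℝ) ^ (-N) * (C₁ * (1 + t⁻¹ ^ d) * ∏ w, (1 + |(cw w)⁻¹| * IN)) * Z :=
    (hSum.tsum_le_tsum hP hS).trans hT
  -- final arithmetic: `t^d (1 + t^{-d}) ≤ 2`, `Π_w (1 + |c_w|⁻¹ I_N) ≤ (1 + λ⁻¹ I_N)^d`
  have hPQ : ∏ w, (1 + |(cw w)⁻¹| * IN) ≤ Q := by
    rw [hQdef, hddef, ← Finset.card_univ, ← Finset.prod_const]
    refine Finset.prod_le_prod (fun w _ => by positivity) fun w _ => ?_
    have h : |(cw w)⁻¹| ≤ lam⁻¹ := by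
      rw [abs_inv]
      exact inv_anti₀ hlam0 (hcw w)
    nlinarith
  have hkey : t ^ d * (1 + t⁻¹ ^ d) ≤ 2 := by
    rw [mul_add, mul_one, ← mul_pow, mul_inv_cancel₀ ht0.ne', one_pow]
    have h : t ^ d ≤ 1 := pow_le_one₀ ht0.le hs1
    linarith
  have hprod0 : 0 ≤ ∏ w, (1 + |(cw w)⁻¹| * IN) := Finset.prod_nonneg fun w _ => by positivity
  show t ^ d * ∑' ξ : K, ((vecHeight K (![1, η ξ] : Fin 2 → AdeleRing (𝓞 K) K) : ℝ≥0) : ℝ) ^ (-N) ≤ _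
  calc t ^ d * ∑' ξ : K, ((vecHeight K (![1, η ξ] : Fin 2 → AdeleRing (𝓞 K) K) : ℝ≥0) : ℝ) ^ (-N)
      ≤ t ^ d * ((c : ℝ) ^ (-N) * (C₁ * (1 + t⁻¹ ^ d) * ∏ w, (1 + |(cw w)⁻¹| * IN)) * Z) :=
        mul_le_mul_of_nonneg_left htsum (pow_nonneg ht0.le _)
    _ = ((c : ℝ) ^ (-N) * C₁ * Z) * ((t ^ d * (1 + t⁻¹ ^ d)) * ∏ w, (1 + |(cw w)⁻¹| * IN)) := by ring
    _ ≤ ((c : ℝ) ^ (-N) * C₁ * Z) * (2 * Q) :=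
        mul_le_mul_of_nonneg_left (mul_le_mul hkey hPQ hprod0 zero_le_two)
          (mul_nonneg (mul_nonneg hcN0.le hC₁0) hZ0)
    _ = 2 * (c : ℝ) ^ (-N) * C₁ * Q * Z := by ring

end Literature.NumberTheory.Automorphic
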